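import Mathlib
import Literature.NumberTheory.LFunctions.Zhang2022.SkeletonPartThree
import HarnessLib

/-!
# Zhang (2022), Appendix B, proof of Lemma 15.1 — reduction lemmas: divisor-pair combinatorics,
# multiplicativity of `ϱ*_j`, and the common-prime tail (GAP-LEDGER row G-d50-1, part 1 of 2)

Topic `Literature/NumberTheory/LFunctions/Zhang2022` (Landau–Siegel audit tree; verdict-neutral).
Y. Zhang, *Discrete mean estimates and the Landau–Siegel zero*, arXiv:2211.02515v1 (2022)
[Zhang2022LandauSiegel] — an unrefereed manuscript under adjudication; nothing here bears on its
Theorems 1–2. Elementary inputs for the unprinted reduction step of the proof of Lemma 15.1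
(node `Z22:Lem15.1.pf` [Z22 pp.106–107, tex L5248–L5286]; the reduction is
`AppendixBLemma151Reduction.lemma151_hdec`): regrouping
`Σ_{n∈S}Σ_{uv=n}` over pairs, `ϱ*_j` (15.21) multiplicative with `|ϱ*_j| ≤ τ₂`, and the tail over
pairs coprime to `𝔮 = ∏_{q<D⁴} q` sharing a prime: `≤ 16(Σ_{m<N}1/m)⁴/D⁴` (`common_prime_tail_le`).
[cite: Zhang2022LandauSiegel, App. B, proof of Lemma 15.1]
-/

noncomputable section

open Complex Real ComplexConjugate Finset

namespace Literature.NumberTheory.LFunctions.Zhang2022.Skeleton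

/-! ## §1. Divisor-pair combinatorics -/

/-- **Regrouping a sum over `n ∈ S` of sums over the divisor pairs of `n`** as a sum over pairs:
if `S` contains no `0` and is closed under taking divisors, then
`Σ_{n∈S} Σ_{uv=n} F(u,v) = Σ_{(u,v)∈S×S, uv∈S} F(u,v)`. [cite: Zhang2022LandauSiegel, App. B p.106] -/
theorem sum_sum_divisorsAntidiagonal_eq {M : Type*} [AddCommMonoid M] (S : Finset ℕ)
    (h0 : 0 ∉ S) (hdiv : ∀ n ∈ S, ∀ d : ℕ, d ∣ n → d ∈ S) (F : ℕ × ℕ → M) :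
    ∑ n ∈ S, ∑ y ∈ n.divisorsAntidiagonal, F y =
      ∑ y ∈ (S ×ˢ S).filter (fun y => y.1 * y.2 ∈ S), F y := by
  classical
  have h1 : ∀ n ∈ S, ∑ y ∈ n.divisorsAntidiagonal, F y =
      ∑ y ∈ S ×ˢ S, (if y.1 * y.2 = n then F y else 0) := by
    intro n hn
    rw [← Finset.sum_filter]
    refine Finset.sum_congr ?_ fun _ _ => rfl
    ext y
    simp only [Nat.mem_divisorsAntidiagonal, Finset.mem_filter, Finset.mem_product]
    constructor
    · rintro ⟨hy, hn0⟩
      exact ⟨⟨hdiv n hn y.1 ⟨y.2, hy.symm⟩, hdiv n hn y.2 ⟨y.1, by rw [mul_comm]; exact hy.symm⟩⟩, hy⟩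
    · rintro ⟨_, hy⟩
      refine ⟨hy, ?_⟩
      rintro rfl
      exact h0 hn
  rw [Finset.sum_congr rfl h1, Finset.sum_comm, Finset.sum_filter]
  refine Finset.sum_congr rfl fun y _ => ?_
  rw [Finset.sum_ite_eq]

/-! ## §2. `ϱ*_j` is multiplicative and `|ϱ*_j| ≤ τ₂` -/

section Varrho

variable (c' : ℝ) {D : ℕ} (χ : DirichletCharacter ℂ D)

/-- `Re β_j = 0` for every index `j` (`β_j ∈ {β₁, β₂, β₃}`, all purely imaginary).
[cite: Zhang2022LandauSiegel, §2 (2.13)] -/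
private theorem re_betaJ_eq_zero (j : ℕ) : (betaJ c' D j).re = 0 := by
  rw [betaJ]
  split_ifs <;> simp [beta1, beta2, beta3]

/-- `|d^{β_j}| = 1` for `d ≥ 1`. [cite: Zhang2022LandauSiegel, §15 (15.21)] -/
private theorem norm_natCast_cpow_betaJ' {d : ℕ} (hd : d ≠ 0) (j : ℕ) : ‖(d : ℂ) ^ betaJ c' D j‖ = 1 := by
  rw [Complex.norm_natCast_cpow_of_pos (Nat.pos_of_ne_zero hd), re_betaJ_eq_zero, Real.rpow_zero]

/-- **`|ϱ*_j(n)| ≤ τ₂(n)`** (each term `d^{β_j}χ(d)` has modulus `≤ 1`).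
[cite: Zhang2022LandauSiegel, §15 (15.21)] -/
theorem norm_varrhoStar_le (j n : ℕ) : ‖varrhoStar c' χ j n‖ ≤ n.divisors.card := by
  rw [varrhoStar]
  refine (norm_sum_le _ _).trans ?_
  have : ∀ d ∈ n.divisors, ‖(d : ℂ) ^ betaJ c' D j * χ (d : ZMod D)‖ ≤ 1 := fun d hd => by
    rw [norm_mul, norm_natCast_cpow_betaJ' c' (Nat.pos_of_mem_divisors hd).ne' j, one_mul]
    exact DirichletCharacter.norm_le_one χ _
  refine (Finset.sum_le_sum this).trans ?_
  simp

/-- `Σ_{d∣mn} F(d) = Σ_{a∣m}Σ_{b∣n} F(ab)`, `(m,n) = 1`. [folklore] -/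
private theorem sum_divisors_mul_of_coprime' {M : Type*} [AddCommMonoid M] {m n : ℕ}
    (hmn : m.Coprime n) (F : ℕ → M) :
    ∑ d ∈ (m * n).divisors, F d = ∑ a ∈ m.divisors, ∑ b ∈ n.divisors, F (a * b) := by
  rw [Nat.divisors_mul, ← Finset.image_mul_product, Finset.sum_image hmn.mul_injOn_divisors,
    Finset.sum_product]

/-- **`ϱ*_j` is multiplicative**: `ϱ*_j(uv) = ϱ*_j(u)ϱ*_j(v)` for `(u,v) = 1` (`ϱ*_j = (χ·id^{β_j}) ∗ 1`).
[cite: Zhang2022LandauSiegel, §15 (15.21)] -/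
theorem varrhoStar_mul_of_coprime (j : ℕ) {u v : ℕ} (huv : Nat.Coprime u v) :
    varrhoStar c' χ j (u * v) = varrhoStar c' χ j u * varrhoStar c' χ j v := by
  rw [varrhoStar, varrhoStar, varrhoStar, sum_divisors_mul_of_coprime' huv, Finset.sum_mul_sum]
  refine Finset.sum_congr rfl fun a _ => Finset.sum_congr rfl fun b _ => ?_
  rw [Nat.cast_mul, Complex.natCast_mul_natCast_cpow, Nat.cast_mul, map_mul]
  ring

/-- `τ₂(uv) ≤ τ₂(u)τ₂(v)` (any `u, v`). [folklore] -/
private theorem card_divisors_mul_le (u v : ℕ) :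
    (u * v).divisors.card ≤ u.divisors.card * v.divisors.card := by
  rw [Nat.divisors_mul]; exact Finset.card_mul_le

/-- **The cross term**: `|ϱ*_j(uv) − ϱ*_j(u)ϱ*_j(v)| ≤ 2τ₂(u)τ₂(v)`, and `= 0` when `(u,v) = 1`.
[cite: Zhang2022LandauSiegel, App. B p.106] -/
theorem norm_varrhoStar_mul_sub_le (j u v : ℕ) :
    ‖varrhoStar c' χ j (u * v) - varrhoStar c' χ j u * varrhoStar c' χ j v‖ ≤
      2 * (u.divisors.card * v.divisors.card : ℝ) := by
  refine (norm_sub_le _ _).trans ?_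
  rw [norm_mul, two_mul]
  refine add_le_add ?_ ?_
  · refine (norm_varrhoStar_le c' χ j _).trans ?_
    exact_mod_cast card_divisors_mul_le u v
  · exact mul_le_mul (norm_varrhoStar_le c' χ j u) (norm_varrhoStar_le c' χ j v) (norm_nonneg _)
      (Nat.cast_nonneg _)

end Varrho

/-! ## §3. The tail over pairs with a common prime factor `q ≥ D⁴` -/

section Tail

/-- `Σ_{m<N} 1/m ≤ 1 + log N` (harmonic numbers). [folklore] -/
private theorem sum_Ico_one_div_le_one_add_log (N : ℕ) :
    ∑ m ∈ Finset.Ico 1 N, (1 / (m : ℝ)) ≤ 1 + Real.log N := by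
  rcases Nat.eq_zero_or_pos N with rfl | hN
  · simp
  have hIco : Finset.Ico 1 N = Finset.Icc 1 (N - 1) := by
    ext m; simp only [Finset.mem_Ico, Finset.mem_Icc]; omega
  have h1 : ∑ m ∈ Finset.Icc 1 (N - 1), (1 / (m : ℝ)) = ((harmonic (N - 1) : ℚ) : ℝ) := by
    rw [harmonic_eq_sum_Icc]; push_cast; simp [one_div]
  rw [hIco, h1]
  refine (harmonic_le_one_add_log (N - 1)).trans ?_
  rcases Nat.eq_zero_or_pos (N - 1) with h | h
  · rw [h]; simp; exact Real.log_natCast_nonneg N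
  · have : Real.log ((N - 1 : ℕ) : ℝ) ≤ Real.log N :=
      Real.log_le_log (by exact_mod_cast h) (by exact_mod_cast Nat.sub_le N 1)
    linarith

/-- `Σ_{m<N} τ₂(m)/m ≤ (Σ_{m<N} 1/m)²` (`τ₂(m)/m = Σ_{ab=m} (ab)⁻¹`, then forget `ab < N`).
[folklore] -/
private theorem sum_Ico_card_divisors_div_le (N : ℕ) :
    ∑ m ∈ Finset.Ico 1 N, ((m.divisors.card : ℝ) / m) ≤ (∑ m ∈ Finset.Ico 1 N, (1 / (m : ℝ))) ^ 2 := by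
  have hS0 : 0 ∉ Finset.Ico 1 N := by simp
  have hdiv : ∀ n ∈ Finset.Ico 1 N, ∀ d : ℕ, d ∣ n → d ∈ Finset.Ico 1 N := by
    intro n hn d hd
    rw [Finset.mem_Ico] at hn ⊢
    have hn0 : n ≠ 0 := by omega
    exact ⟨Nat.pos_of_ne_zero (ne_zero_of_dvd_ne_zero hn0 hd), lt_of_le_of_lt (Nat.le_of_dvd (by omega) hd) hn.2⟩
  have step : ∀ m ∈ Finset.Ico 1 N, ((m.divisors.card : ℝ) / m) =
      ∑ y ∈ m.divisorsAntidiagonal, (1 / ((y.1 : ℝ) * y.2)) := by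
    intro m hm
    have hm0 : m ≠ 0 := by rw [Finset.mem_Ico] at hm; omega
    have : ∀ y ∈ m.divisorsAntidiagonal, (1 / ((y.1 : ℝ) * y.2)) = 1 / (m : ℝ) := fun y hy => by
      rw [← Nat.cast_mul, (Nat.mem_divisorsAntidiagonal.mp hy).1]
    rw [Finset.sum_congr rfl this, Finset.sum_const, nsmul_eq_mul, ← Nat.map_div_right_divisors,
      Finset.card_map]
    ring
  calc ∑ m ∈ Finset.Ico 1 N, ((m.divisors.card : ℝ) / m)
      = ∑ y ∈ (Finset.Ico 1 N ×ˢ Finset.Ico 1 N).filter (fun y => y.1 * y.2 ∈ Finset.Ico 1 N),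
          (1 / ((y.1 : ℝ) * y.2)) := by
        rw [Finset.sum_congr rfl step, sum_sum_divisorsAntidiagonal_eq _ hS0 hdiv]
    _ = ∑ y ∈ (Finset.Ico 1 N ×ˢ Finset.Ico 1 N).filter (fun y => y.1 * y.2 ∈ Finset.Ico 1 N),
          (1 / (y.1 : ℝ) * (1 / (y.2 : ℝ))) :=
        Finset.sum_congr rfl fun y _ => by rw [one_div_mul_one_div]
    _ ≤ ∑ y ∈ Finset.Ico 1 N ×ˢ Finset.Ico 1 N, (1 / (y.1 : ℝ) * (1 / (y.2 : ℝ))) :=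
        Finset.sum_le_sum_of_subset_of_nonneg
          (Finset.filter_subset (fun y : ℕ × ℕ => y.1 * y.2 ∈ Finset.Ico 1 N) _)
          fun y _ _ => by positivity
    _ = (∑ m ∈ Finset.Ico 1 N, (1 / (m : ℝ))) ^ 2 := by
        rw [sq, Finset.sum_mul_sum, ← Finset.sum_product']

/-- For a prime `q` and `T ⊆ [1, N)`: `Σ_{u∈T, q∣u} τ₂(u)/u ≤ (2/q)·Σ_{m<N} τ₂(m)/m`
(substitute `u = qm`, `τ₂(qm) ≤ 2τ₂(m)`). [cite: Zhang2022LandauSiegel, App. B p.106] -/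
private theorem sum_filter_dvd_card_div_le {q N : ℕ} (hq : q.Prime) {T : Finset ℕ}
    (hT : T ⊆ Finset.Ico 1 N) :
    ∑ u ∈ T.filter (fun u => q ∣ u), ((u.divisors.card : ℝ) / u) ≤
      2 / q * ∑ m ∈ Finset.Ico 1 N, ((m.divisors.card : ℝ) / m) := by
  have hq0 : q ≠ 0 := hq.ne_zero
  have hinj : Set.InjOn (fun m : ℕ => q * m) ↑(Finset.Ico 1 N) := fun a _ b _ h =>
    Nat.eq_of_mul_eq_mul_left hq.pos h
  have hsub : T.filter (fun u => q ∣ u) ⊆ (Finset.Ico 1 N).image (fun m => q * m) := by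
    intro u hu
    rw [Finset.mem_filter] at hu
    obtain ⟨m, rfl⟩ := hu.2
    have hm := hT hu.1
    rw [Finset.mem_Ico] at hm
    refine Finset.mem_image.mpr ⟨m, Finset.mem_Ico.mpr ⟨?_, ?_⟩, rfl⟩
    · rcases Nat.eq_zero_or_pos m with rfl | h
      · simp at hm
      · exact h
    · exact lt_of_le_of_lt (Nat.le_mul_of_pos_left m hq.pos) hm.2
  calc ∑ u ∈ T.filter (fun u => q ∣ u), ((u.divisors.card : ℝ) / u)
      ≤ ∑ u ∈ (Finset.Ico 1 N).image (fun m => q * m), ((u.divisors.card : ℝ) / u) :=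
        Finset.sum_le_sum_of_subset_of_nonneg hsub fun u _ _ => by positivity
    _ = ∑ m ∈ Finset.Ico 1 N, (((q * m).divisors.card : ℝ) / ((q * m : ℕ) : ℝ)) :=
        Finset.sum_image hinj
    _ ≤ ∑ m ∈ Finset.Ico 1 N, (2 / q * ((m.divisors.card : ℝ) / m)) := by
        refine Finset.sum_le_sum fun m hm => ?_
        have hm0 : (0 : ℝ) < m := by rw [Finset.mem_Ico] at hm; exact_mod_cast hm.1
        have hq' : (0 : ℝ) < q := by exact_mod_cast hq.pos
        have hcard : ((q * m).divisors.card : ℝ) ≤ 2 * m.divisors.card := by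
          have h1 := card_divisors_mul_le q m
          rw [Nat.Prime.divisors hq, Finset.card_pair hq.one_lt.ne] at h1
          exact_mod_cast h1
        rw [Nat.cast_mul, div_le_iff₀ (mul_pos hq' hm0)]
        calc ((q * m).divisors.card : ℝ) ≤ 2 * m.divisors.card := hcard
          _ = 2 / q * ((m.divisors.card : ℝ) / m) * (q * m) := by field_simp
    _ = 2 / q * ∑ m ∈ Finset.Ico 1 N, ((m.divisors.card : ℝ) / m) := by rw [Finset.mul_sum]

/-- `Σ_{a ≤ q < b} q⁻² ≤ 2/a` for `a ≥ 1`. [folklore] -/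
private theorem sum_Ico_inv_sq_le {a b : ℕ} (ha : 1 ≤ a) :
    ∑ q ∈ Finset.Ico a b, (1 / (q : ℝ) ^ 2) ≤ 2 / (a : ℝ) := by
  have h : Finset.Ico a b = Finset.Ioo (a - 1) b := by
    ext q; simp only [Finset.mem_Ico, Finset.mem_Ioo]; omega
  rw [h]
  have := sum_Ioo_inv_sq_le (α := ℝ) (a - 1) b
  simp only [one_div]
  refine this.trans (le_of_eq ?_)
  rw [Nat.cast_sub ha]; ring

/-- **The common-prime tail.** For `T ⊆ [1,N)` all of whose members are coprime to `𝔮 = ∏_{q<D⁴} q`: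
`Σ_{u,v∈T, (u,v)>1} 2τ₂(u)τ₂(v)/(uv) ≤ 16·(Σ_{m<N} 1/m)⁴/D⁴` (a common prime factor of `u, v` is
`≥ D⁴`; union bound over it). [cite: Zhang2022LandauSiegel, App. B p.106] -/
theorem common_prime_tail_le {D N : ℕ} (hD : 1 ≤ D) {T : Finset ℕ} (hT : T ⊆ Finset.Ico 1 N)
    (hcop : ∀ u ∈ T, Nat.Coprime u (frakq D)) :
    ∑ u ∈ T, ∑ v ∈ T,
        (if Nat.Coprime u v then (0 : ℝ) else 2 * ((u.divisors.card : ℝ) * v.divisors.card) / ((u : ℝ) * v))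
      ≤ 16 * (∑ m ∈ Finset.Ico 1 N, (1 / (m : ℝ))) ^ 4 / (D : ℝ) ^ 4 := by
  have hK : (∑ m ∈ Finset.Ico 1 N, ((m.divisors.card : ℝ) / m)) ≤
      (∑ m ∈ Finset.Ico 1 N, (1 / (m : ℝ))) ^ 2 := sum_Ico_card_divisors_div_le N
  have hH0 : 0 ≤ ∑ m ∈ Finset.Ico 1 N, (1 / (m : ℝ)) := Finset.sum_nonneg fun m _ => by positivity
  set H : ℝ := ∑ m ∈ Finset.Ico 1 N, (1 / (m : ℝ)) with hH
  clear_value H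
  set Q : Finset ℕ := (Finset.Ico (D ^ 4) N).filter Nat.Prime with hQ
  clear_value Q
  set a : ℕ → ℝ := fun u => (u.divisors.card : ℝ) / u with ha
  have ha0 : ∀ u, 0 ≤ a u := fun u => by rw [ha]; positivity
  clear_value a
  have hnn : ∀ q u v : ℕ, (0 : ℝ) ≤ 2 * ((if q ∣ u then a u else 0) * (if q ∣ v then a v else 0)) := by
    intro q u v
    refine mul_nonneg zero_le_two (mul_nonneg ?_ ?_)
    · split_ifs
      · exact ha0 u
      · exact le_rfl
    · split_ifs
      · exact ha0 v
      · exact le_rfl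
  -- pointwise: the non-coprime indicator is dominated by the sum over common primes `q ∈ Q`
  have hptw : ∀ u ∈ T, ∀ v ∈ T,
      (if Nat.Coprime u v then (0 : ℝ) else 2 * ((u.divisors.card : ℝ) * v.divisors.card) / ((u : ℝ) * v))
        ≤ ∑ q ∈ Q, (2 * ((if q ∣ u then a u else 0) * (if q ∣ v then a v else 0))) := by
    intro u hu v hv
    split_ifs with huv
    · exact Finset.sum_nonneg fun q _ => hnn q u v
    · have hu1 := hT hu
      rw [Finset.mem_Ico] at hu1
      obtain ⟨q, hqp, hqu, hqv⟩ := Nat.Prime.not_coprime_iff_dvd.mp huv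
      have hqN : q < N := lt_of_le_of_lt (Nat.le_of_dvd (by omega) hqu) hu1.2
      have hqD : D ^ 4 ≤ q := by
        by_contra hlt
        rw [not_le] at hlt
        have hqdvd : q ∣ frakq D := by
          rw [frakq]
          exact Finset.dvd_prod_of_mem _ (Finset.mem_filter.mpr ⟨Finset.mem_range.mpr hlt, hqp⟩)
        have h1 : q ∣ Nat.gcd u (frakq D) := Nat.dvd_gcd hqu hqdvd
        rw [(hcop u hu).gcd_eq_one] at h1
        exact hqp.one_lt.ne' (Nat.dvd_one.mp h1)
      have hqQ : q ∈ Q := by rw [hQ]; exact Finset.mem_filter.mpr ⟨Finset.mem_Ico.mpr ⟨hqD, hqN⟩, hqp⟩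
      have hterm : 2 * ((u.divisors.card : ℝ) * v.divisors.card) / ((u : ℝ) * v) =
          2 * ((if q ∣ u then a u else 0) * (if q ∣ v then a v else 0)) := by
        rw [if_pos hqu, if_pos hqv, ha]
        have hu0 : (u : ℝ) ≠ 0 := by exact_mod_cast (show u ≠ 0 by omega)
        have hv1 := hT hv
        rw [Finset.mem_Ico] at hv1
        have hv0 : (v : ℝ) ≠ 0 := by exact_mod_cast (show v ≠ 0 by omega)
        field_simp
      rw [hterm]
      exact Finset.single_le_sum (f := fun q => 2 * ((if q ∣ u then a u else 0) *
        (if q ∣ v then a v else 0))) (fun q _ => hnn q u v) hqQ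
  -- sum the pointwise bound and factor the double sum for each `q`
  have hfac : ∀ q ∈ Q, ∑ u ∈ T, ∑ v ∈ T, (2 * ((if q ∣ u then a u else 0) * (if q ∣ v then a v else 0)))
      = 2 * (∑ u ∈ T.filter (fun u => q ∣ u), a u) ^ 2 := by
    intro q _
    rw [Finset.sum_filter, sq, Finset.sum_mul_sum, Finset.mul_sum]
    refine Finset.sum_congr rfl fun u _ => ?_
    rw [Finset.mul_sum]
  have hq_bound : ∀ q ∈ Q, 2 * (∑ u ∈ T.filter (fun u => q ∣ u), a u) ^ 2 ≤ 8 * H ^ 4 * (1 / (q : ℝ) ^ 2) := by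
    intro q hq
    have hqp : q.Prime := by rw [hQ] at hq; exact (Finset.mem_filter.mp hq).2
    have hS := sum_filter_dvd_card_div_le hqp hT
    have hS0 : 0 ≤ ∑ u ∈ T.filter (fun u => q ∣ u), a u := Finset.sum_nonneg fun u _ => ha0 u
    have hq0 : (0 : ℝ) < q := by exact_mod_cast hqp.pos
    have h1 : ∑ u ∈ T.filter (fun u => q ∣ u), a u ≤ 2 / q * H ^ 2 := by
      have hK' := hK
      rw [ha] at hK' ⊢
      exact hS.trans (mul_le_mul_of_nonneg_left hK' (by positivity))
    calc 2 * (∑ u ∈ T.filter (fun u => q ∣ u), a u) ^ 2 ≤ 2 * (2 / q * H ^ 2) ^ 2 :=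
          mul_le_mul_of_nonneg_left (pow_le_pow_left₀ hS0 h1 2) zero_le_two
      _ = 8 * H ^ 4 * (1 / (q : ℝ) ^ 2) := by ring
  have hD4 : 1 ≤ D ^ 4 := Nat.one_le_pow _ _ hD
  calc ∑ u ∈ T, ∑ v ∈ T, (if Nat.Coprime u v then (0 : ℝ)
          else 2 * ((u.divisors.card : ℝ) * v.divisors.card) / ((u : ℝ) * v))
      ≤ ∑ u ∈ T, ∑ v ∈ T, ∑ q ∈ Q, (2 * ((if q ∣ u then a u else 0) * (if q ∣ v then a v else 0))) :=
        Finset.sum_le_sum fun u hu => Finset.sum_le_sum fun v hv => hptw u hu v hv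
    _ = ∑ u ∈ T, ∑ q ∈ Q, ∑ v ∈ T, (2 * ((if q ∣ u then a u else 0) * (if q ∣ v then a v else 0))) :=
        Finset.sum_congr rfl fun u _ => Finset.sum_comm
    _ = ∑ q ∈ Q, ∑ u ∈ T, ∑ v ∈ T, (2 * ((if q ∣ u then a u else 0) * (if q ∣ v then a v else 0))) :=
        Finset.sum_comm
    _ = ∑ q ∈ Q, 2 * (∑ u ∈ T.filter (fun u => q ∣ u), a u) ^ 2 := Finset.sum_congr rfl hfac
    _ ≤ ∑ q ∈ Q, 8 * H ^ 4 * (1 / (q : ℝ) ^ 2) := Finset.sum_le_sum hq_bound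
    _ = 8 * H ^ 4 * ∑ q ∈ Q, (1 / (q : ℝ) ^ 2) := by rw [Finset.mul_sum]
    _ ≤ 8 * H ^ 4 * ∑ q ∈ Finset.Ico (D ^ 4) N, (1 / (q : ℝ) ^ 2) := by
        refine mul_le_mul_of_nonneg_left ?_ (by positivity)
        rw [hQ]
        exact Finset.sum_le_sum_of_subset_of_nonneg
          (Finset.filter_subset Nat.Prime (Finset.Ico (D ^ 4) N)) fun q _ _ => by positivity
    _ ≤ 8 * H ^ 4 * (2 / ((D ^ 4 : ℕ) : ℝ)) :=
        mul_le_mul_of_nonneg_left (sum_Ico_inv_sq_le hD4) (by positivity)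
    _ = 16 * H ^ 4 / (D : ℝ) ^ 4 := by push_cast; ring

end Tail

/-- `Σ_{m<⌈P⌉} 1/m ≤ 2𝓛⁹` for `𝓛 ≥ 2` (`log⌈P⌉ ≤ log 2P ≤ 1 + 𝓛⁹`). [cite: Zhang2022LandauSiegel, §2 (2.6)] -/
theorem harmonic_ceil_bigP_le {D : ℕ} (hD : 2 ≤ ell D) :
    ∑ m ∈ Finset.Ico 1 ⌈bigP D⌉₊, (1 / (m : ℝ)) ≤ 2 * ell D ^ 9 := by
  have hP : 0 < bigP D := Real.exp_pos _
  have hP1 : 1 ≤ bigP D := Real.one_le_exp (pow_nonneg (by linarith) _)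
  refine (sum_Ico_one_div_le_one_add_log _).trans ?_
  have hceil : (⌈bigP D⌉₊ : ℝ) ≤ 2 * bigP D := by
    have := Nat.ceil_lt_add_one hP.le
    linarith
  have hceil0 : (0 : ℝ) < ⌈bigP D⌉₊ := by
    have : (1 : ℝ) ≤ ⌈bigP D⌉₊ := by exact_mod_cast Nat.one_le_ceil_iff.mpr hP
    linarith
  have hlog : Real.log (⌈bigP D⌉₊ : ℝ) ≤ Real.log 2 + ell D ^ 9 := by
    calc Real.log (⌈bigP D⌉₊ : ℝ) ≤ Real.log (2 * bigP D) := Real.log_le_log hceil0 hceil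
      _ = Real.log 2 + ell D ^ 9 := by rw [Real.log_mul (by norm_num) hP.ne', bigP, Real.log_exp]
  have h2 : Real.log 2 ≤ 1 := by
    have := Real.log_two_lt_d9; linarith
  have hℓ9 : (2 : ℝ) ≤ ell D ^ 9 :=
    le_trans (by norm_num : (2 : ℝ) ≤ 2 ^ 9) (pow_le_pow_left₀ (by norm_num) hD 9)
  linarith

end Literature.NumberTheory.LFunctions.Zhang2022.Skeleton
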